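import Mathlib
import Literature.NumberTheory.LFunctions.Zhang2022.Section2Lemma23Holds
import Literature.NumberTheory.LFunctions.Zhang2022.SkeletonProp22W
import HarnessLib

/-!
# Zhang (2022) §2, proof of Lemma 2.3 (pp. 11–12), IV: the windowed leaf `Ded23W` DISCHARGED —
# Lemma 2.3 from Proposition 2.2 with (iii) on the inner window, kernel-checked

Topic `Literature/NumberTheory/LFunctions/Zhang2022` (Landau–Siegel adjudication tree;
verdict-neutral). Y. Zhang, *Discrete mean estimates and the Landau–Siegel zero*,
arXiv:2211.02515v1 (2022) [Zhang2022LandauSiegel] — an unrefereed manuscript under adjudication.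
DAG node `Z22:Lem2.3.pf` [Z22 p.11, tex L667–L685] (proof of Lemma 2.3 from Proposition 2.2).

After the cell's ruling on the §4 seams (`SkeletonProp22W.lean`, p414559) the node of record for
Proposition 2.2 is `Skeleton.Prop22W c′ = Prop22i ∧ Prop22ii ∧ Prop22iiiW c′`, in which the gap
assertion (iii) is only asserted for consecutive pairs whose LOWER zero has `|γ − 2πt₀| < 𝓛₁ + 3/2`,
and the leaf of the whole-DAG theorem (v7) is `Skeleton.Ded23W c′ := Prop22W c′ → Lemma23 c′`.
The manuscript's proof of Lemma 2.3 uses (iii) only at a zero `ρ ∈ 𝔷(ψ)` (`|γ − 2πt₀| < 𝓛₁`) and at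
the two zeros consecutive to it above (heights `< γ + 2α + 2c′α²𝓛 < γ + 3/2`), so the windowed
form suffices. This file PROVES `Skeleton.ded23W_holds : 0 ≤ c′ → Ded23W c′` along the lines of
`Section2Lemma23Inputs.lean` / `Section2Lemma23Holds.lean` (whose sign lemmas, finiteness of the
`Ω`-zeros, `M(½+iu,ψ)` facts and `𝔠*`-algebra are reused verbatim):

* `im_gt_of_gapW`, `exists_next_above_gapW`, `im_gt_of_gap_threeW` — the consecutive-zero
  combinatorics with the window hypothesis on the lower zero;
* `Mfun_half_ne_zero_of_prop22W_at` — "`M(ρ+iv,ψ) ≠ 0` for `0 < v ≤ |β₁|` and `|β₂| ≤ v ≤ |β₃|`"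
  from (iii) windowed;
* `M_signs_of_zeroFree_at` — the two sign statements (`M(ρ+β₁)/(iM′(ρ)) > 0`,
  `M(ρ+β₂)M(ρ+β₃) > 0`) from the zero-free ranges, `Re ρ = ½` and `L′(ρ,ψ) ≠ 0` ALONE (the
  analytic heart of the printed proof, now stated independently of how the ranges are obtained);
* `cstar_nonneg_of_prop22W_at`, `forAllLarge_of_prop22W`, `ded23W_holds`.

No new definitions, no named facts; nothing here bears on Theorems 1–2 of the source or on the
cell's verdict on (8.24). Cell siegel-zhang (D-0069), cone C11, sz-skel ACTION 2026-08-26T00:46Z.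

## References

* Y. Zhang, arXiv:2211.02515v1 (2022), §2: Proposition 2.2 (iii) p. 7, (2.13), (2.14), proof of
  Lemma 2.3 pp. 11–12 (tex L667–L685). [cite: Zhang2022LandauSiegel, §2 Lemma 2.3 (proof) pp. 11–12]
-/

noncomputable section

open Complex Real Filter Topology Set

namespace Literature.NumberTheory.LFunctions.Zhang2022.Skeleton

/-! ## Consecutive zeros under the windowed gap assertion -/

/-- The next zero above `s`, with the gap bounds, when (iii) is only known for lower zeros in a
window `|Im s − T| < W` containing `s`. [cite: Zhang2022LandauSiegel, §2 Prop. 2.2 (iii) p. 7] -/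
theorem exists_next_above_gapW {S : Set ℂ} (hS : S.Finite) {a e T W : ℝ}
    (hgap : ∀ s ∈ S, ∀ s' ∈ S, |s.im - T| < W → s.im < s'.im →
      (∀ s'' ∈ S, ¬ (s.im < s''.im ∧ s''.im < s'.im)) → |s'.im - s.im - a| < e)
    {s z : ℂ} (hs : s ∈ S) (hsW : |s.im - T| < W) (hz : z ∈ S) (hsz : s.im < z.im) :
    ∃ w ∈ S, s.im + a - e < w.im ∧ w.im < s.im + a + e ∧
      ∀ u ∈ S, s.im < u.im → w.im ≤ u.im := by
  obtain ⟨w, hw, hlt, hmin⟩ := exists_next_above hS hz hsz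
  have h := hgap s hs w hw hsW hlt (fun u hu hu' => (not_le.mpr hu'.2) (hmin u hu hu'.1))
  rw [abs_lt] at h
  exact ⟨w, hw, by linarith [h.1], by linarith [h.2], hmin⟩

/-- Every point of `S` above a windowed `s ∈ S` is higher than `Im s + a − e`.
[cite: Zhang2022LandauSiegel, §2 proof of Lemma 2.3 p. 11] -/
theorem im_gt_of_gapW {S : Set ℂ} (hS : S.Finite) {a e T W : ℝ}
    (hgap : ∀ s ∈ S, ∀ s' ∈ S, |s.im - T| < W → s.im < s'.im →
      (∀ s'' ∈ S, ¬ (s.im < s''.im ∧ s''.im < s'.im)) → |s'.im - s.im - a| < e)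
    {s z : ℂ} (hs : s ∈ S) (hsW : |s.im - T| < W) (hz : z ∈ S) (hsz : s.im < z.im) :
    s.im + a - e < z.im := by
  obtain ⟨w, -, h1, -, hmin⟩ := exists_next_above_gapW hS hgap hs hsW hz hsz
  exact lt_of_lt_of_le h1 (hmin z hz hsz)

/-- No point of `S` has height in `[Im s + 2a + 2e, Im s + 3a − 3e]` when `s ∈ S` sits in the
narrower window `|Im s − T| < W₀` with `W₀ + 2(a + e) ≤ W` (the next two zeros above `s` then lie
in the window `W`, so (iii) applies at them too). [cite: Zhang2022LandauSiegel, §2 proof of Lemma 2.3 p. 11] -/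
theorem im_gt_of_gap_threeW {S : Set ℂ} (hS : S.Finite) {a e T W W₀ : ℝ} (ha : 0 ≤ a)
    (hae : 0 < a + e) (hW : W₀ + 2 * (a + e) ≤ W)
    (hgap : ∀ s ∈ S, ∀ s' ∈ S, |s.im - T| < W → s.im < s'.im →
      (∀ s'' ∈ S, ¬ (s.im < s''.im ∧ s''.im < s'.im)) → |s'.im - s.im - a| < e)
    {s z : ℂ} (hs : s ∈ S) (hsW : |s.im - T| < W₀) (hz : z ∈ S)
    (h2 : s.im + 2 * a + 2 * e ≤ z.im) : s.im + 3 * a - 3 * e < z.im := by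
  have hs0 := abs_lt.mp hsW
  obtain ⟨s₁, hs₁, h1l, h1u, -⟩ := exists_next_above_gapW hS hgap hs
    (by rw [abs_lt]; constructor <;> linarith) hz (by linarith)
  obtain ⟨s₂, hs₂, h2l, h2u, -⟩ := exists_next_above_gapW hS hgap hs₁
    (by rw [abs_lt]; constructor <;> linarith) hz (by linarith)
  obtain ⟨s₃, -, h3l, -, hmin₃⟩ := exists_next_above_gapW hS hgap hs₂
    (by rw [abs_lt]; constructor <;> linarith) hz (by linarith)
  have h3 := hmin₃ z hz (by linarith)
  linarith

/-! ## The zero-free ranges above `ρ ∈ 𝔷(ψ)` from the windowed (iii) -/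

section Setting

variable {D : ℕ} [NeZero D] (χ : DirichletCharacter ℂ D)

/-- **"`M(ρ+iv,ψ) ≠ 0` if `0 < v ≤ |β₁|`" and "… if `|β₂| ≤ v ≤ |β₃|`"** (p. 11) for the skeleton's
`M`, at one `ρ ∈ 𝔷(ψ)`, from the WINDOWED gap assertion (iii) at one character (lower zero in
`|γ − 2πt₀| < 𝓛₁ + 3/2`): for `D ≥ 3`, `χ` primitive, `c′ ≥ 0`, `5c′α𝓛 < 1`, `α ≤ 1/2`.
[cite: Zhang2022LandauSiegel, §2 proof of Lemma 2.3 p. 11] -/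
theorem Mfun_half_ne_zero_of_prop22W_at (hD : 3 ≤ D) (hχ : χ.IsPrimitive) {c' : ℝ}
    (hc' : 0 ≤ c') (hsmall : 5 * c' * alpha D * ell D < 1) (hαhalf : alpha D ≤ 1 / 2) (x : Chr D)
    (h_iii : ∀ s ∈ prodZeroSetOmega χ x, ∀ s' ∈ prodZeroSetOmega χ x,
      |s.im - 2 * π * t0 D| < ell1 D + 3 / 2 → s.im < s'.im →
        (∀ s'' ∈ prodZeroSetOmega χ x, ¬ (s.im < s''.im ∧ s''.im < s'.im)) →
          |s'.im - s.im - alpha D| < c' * alpha D ^ 2 * ell D)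
    {ρ : ℂ} (hρ : ρ ∈ zeroSet D x) {u : ℝ}
    (hu : (ρ.im < u ∧ u ≤ ρ.im + alpha D * (1 - 5 * c' * alpha D * ell D)) ∨
      (ρ.im + 2 * alpha D * (1 + c' * alpha D * ell D) ≤ u ∧
        u ≤ ρ.im + 3 * alpha D * (1 - c' * alpha D * ell D))) :
    Mfun x.ψ ((1 : ℂ) / 2 + u * I) ≠ 0 := by
  have hρS : ρ ∈ prodZeroSetOmega χ x := mem_prodZeroSetOmega_of_mem_zeroSet χ hρ
  have hγ : 0 < ρ.im := im_pos_of_mem_zeroSet hD hρ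
  have hρW : |ρ.im - 2 * π * t0 D| < ell1 D := hρ.2.1
  have hℓ : 1 < ell D := one_lt_ell hD
  have hα : 0 < alpha D := by
    rw [alpha, bigP, Real.log_exp]; exact div_pos Real.pi_pos (pow_pos (by linarith) _)
  have he : 0 ≤ c' * alpha D ^ 2 * ell D := by positivity
  have h5e : 5 * (c' * alpha D ^ 2 * ell D) < alpha D := by
    have : 5 * (c' * alpha D ^ 2 * ell D) = alpha D * (5 * c' * alpha D * ell D) := by ring
    rw [this]; nlinarith
  have hv₁ : alpha D * (1 - 5 * c' * alpha D * ell D) = alpha D - 5 * (c' * alpha D ^ 2 * ell D) := by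
    ring
  have hv₂ : 2 * alpha D * (1 + c' * alpha D * ell D)
      = 2 * alpha D + 2 * (c' * alpha D ^ 2 * ell D) := by ring
  have hv₃ : 3 * alpha D * (1 - c' * alpha D * ell D)
      = 3 * alpha D - 3 * (c' * alpha D ^ 2 * ell D) := by ring
  rw [hv₁, hv₂, hv₃] at hu
  have hu0 : ρ.im < u := by rcases hu with ⟨h, -⟩ | ⟨h, -⟩ <;> linarith
  have hu2 : u < ρ.im + 2 := by rcases hu with ⟨-, h⟩ | ⟨-, h⟩ <;> linarith
  have hfin := prodZeroSetOmega_finite χ hD hχ x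
  have hL : x.ψ.LFunction ((1 : ℂ) / 2 + u * I) ≠ 0 := by
    intro h0
    have hz : (1 : ℂ) / 2 + u * I ∈ prodZeroSetOmega χ x :=
      ⟨half_add_mem_Omega hρ hu0.le hu2, by rw [h0, zero_mul]⟩
    have hzim : ((1 : ℂ) / 2 + u * I).im = u := by simp
    rcases hu with ⟨h1, h2⟩ | ⟨h1, h2⟩
    · have h := im_gt_of_gapW hfin h_iii hρS (by linarith [hρW]) hz (by rw [hzim]; exact h1)
      rw [hzim] at h
      linarith
    · have h := im_gt_of_gap_threeW hfin (W₀ := ell1 D) hα.le (by linarith) (by nlinarith)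
        h_iii hρS hρW hz (by rw [hzim]; linarith)
      rw [hzim] at h
      linarith
  exact Mfun_ne_zero x (by simpa using lt_trans hγ hu0) hL

/-! ## The analytic heart of the proof, from the zero-free ranges -/

omit [NeZero D] in
/-- **The two sign statements of the proof of Lemma 2.3, from the zero-free ranges** (pp. 11–12):
for `D ≥ 3`, `c′ ≥ 0` with `5c′α𝓛 < 1`, `α ≤ 1/2`, a zero `ρ ∈ 𝔷(ψ)` on the critical line with
`L′(ρ,ψ) ≠ 0`, if `M(½+iu,ψ) ≠ 0` for `γ < u ≤ γ+|β₁|` and for `γ+|β₂| ≤ u ≤ γ+|β₃|`, then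
`M(ρ+β₁)/(iM′(ρ))` and `M(ρ+β₂)M(ρ+β₃)` are positive reals ("mean-value theorem" = intermediate
values of the real continuous `M(½+it)`; the limit `v → 0⁺` = the right-hand slope at `γ`).
[cite: Zhang2022LandauSiegel, §2 proof of Lemma 2.3 pp. 11–12] -/
theorem M_signs_of_zeroFree_at (hD : 3 ≤ D) {c' : ℝ} (hc' : 0 ≤ c')
    (hsmall : 5 * c' * alpha D * ell D < 1) (x : Chr D)
    {ρ : ℂ} (hρ : ρ ∈ zeroSet D x) (hre : ρ.re = 1 / 2) (hL1 : deriv x.ψ.LFunction ρ ≠ 0)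
    (hfree : ∀ u : ℝ, ((ρ.im < u ∧ u ≤ ρ.im + alpha D * (1 - 5 * c' * alpha D * ell D)) ∨
      (ρ.im + 2 * alpha D * (1 + c' * alpha D * ell D) ≤ u ∧
        u ≤ ρ.im + 3 * alpha D * (1 - c' * alpha D * ell D))) →
      Mfun x.ψ ((1 : ℂ) / 2 + u * I) ≠ 0) :
    ((Mfun x.ψ (ρ + beta1 c' D) / (I * deriv (Mfun x.ψ) ρ)).im = 0 ∧
      0 < (Mfun x.ψ (ρ + beta1 c' D) / (I * deriv (Mfun x.ψ) ρ)).re) ∧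
    ((Mfun x.ψ (ρ + beta2 c' D) * Mfun x.ψ (ρ + beta3 c' D)).im = 0 ∧
      0 < (Mfun x.ψ (ρ + beta2 c' D) * Mfun x.ψ (ρ + beta3 c' D)).re) := by
  have hγ : 0 < ρ.im := im_pos_of_mem_zeroSet hD hρ
  have hρeq : ρ = (1 : ℂ) / 2 + (ρ.im : ℂ) * I := Complex.ext (by simp [hre]) (by simp)
  have hL0 : x.ψ.LFunction ρ = 0 := hρ.2.2
  have hℓ : 1 < ell D := one_lt_ell hD
  have hα : 0 < alpha D := by
    rw [alpha, bigP, Real.log_exp]; exact div_pos Real.pi_pos (pow_pos (by linarith) _)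
  set e : ℝ := c' * alpha D ^ 2 * ell D with he_def
  have he : 0 ≤ e := by positivity
  have h5e : 5 * e < alpha D := by
    have : 5 * e = alpha D * (5 * c' * alpha D * ell D) := by rw [he_def]; ring
    rw [this]; nlinarith
  set v₁ : ℝ := alpha D * (1 - 5 * c' * alpha D * ell D) with hv₁_def
  set v₂ : ℝ := 2 * alpha D * (1 + c' * alpha D * ell D) with hv₂_def
  set v₃ : ℝ := 3 * alpha D * (1 - c' * alpha D * ell D) with hv₃_def
  have hv₁ : v₁ = alpha D - 5 * e := by rw [hv₁_def, he_def]; ring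
  have hv₂ : v₂ = 2 * alpha D + 2 * e := by rw [hv₂_def, he_def]; ring
  have hv₃ : v₃ = 3 * alpha D - 3 * e := by rw [hv₃_def, he_def]; ring
  have hv₁pos : 0 < v₁ := by rw [hv₁]; linarith
  have hv₂₃ : v₂ ≤ v₃ := by rw [hv₂, hv₃]; linarith
  have hv₂pos : 0 < v₂ := by rw [hv₂]; linarith
  have hβ₁ : ρ + beta1 c' D = (1 : ℂ) / 2 + ((ρ.im + v₁ : ℝ) : ℂ) * I := add_beta1_eq hre
  have hβ₂ : ρ + beta2 c' D = (1 : ℂ) / 2 + ((ρ.im + v₂ : ℝ) : ℂ) * I := add_beta2_eq hre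
  have hβ₃ : ρ + beta3 c' D = (1 : ℂ) / 2 + ((ρ.im + v₃ : ℝ) : ℂ) * I := add_beta3_eq hre
  -- the real function `m(u) = M(½+iu,ψ)` and its zeros
  set m : ℝ → ℝ := fun u => (Mfun x.ψ ((1 : ℂ) / 2 + u * I)).re with hm_def
  have hm0 : m ρ.im = 0 := by
    simp only [hm_def]
    rw [← hρeq, show Mfun x.ψ ρ = Yroot x.ψ ρ * x.ψ.LFunction ρ from rfl, hL0, mul_zero,
      Complex.zero_re]
  have hmne : ∀ u : ℝ, ((ρ.im < u ∧ u ≤ ρ.im + v₁) ∨ (ρ.im + v₂ ≤ u ∧ u ≤ ρ.im + v₃)) → m u ≠ 0 := by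
    intro u hu hmu
    have hupos : 0 < u := by rcases hu with ⟨h, -⟩ | ⟨h, -⟩ <;> linarith
    apply hfree u hu
    rw [Mfun_half_eq_ofReal x hupos]
    simp only [hm_def] at hmu
    rw [hmu, Complex.ofReal_zero]
  -- the derivative at `γ = Im ρ`
  obtain ⟨hderiv, hIim⟩ := hasDerivAt_Mfun_half_re x hγ
  rw [← hρeq] at hderiv hIim
  set d : ℂ := deriv (Mfun x.ψ) ρ with hd_def
  set r : ℝ := (I * d).re with hr_def
  have hId : I * d = (r : ℂ) := Complex.ext (by simp [hr_def]) (by rw [hIim, Complex.ofReal_im])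
  have hd0 : d ≠ 0 :=
    GammaFactor.deriv_M_ne_zero_of_simple_zero x.prim x.p_ne_one (Yroot_spec x.prim).1
      (Yroot_spec x.prim).2 hγ hL0 hL1
  have hr0 : r ≠ 0 := by
    intro h
    rw [h, Complex.ofReal_zero] at hId
    exact (mul_ne_zero I_ne_zero hd0) hId
  have hsign₁ : 0 < r * m (ρ.im + v₁) :=
    mul_pos_of_hasDerivAt_of_ne_zero (by linarith) (continuousOn_Mfun_half_re x hγ)
      (fun u hu => hmne u (Or.inl ⟨hu.1, hu.2⟩)) hm0 hderiv hr0
  have hsign₂₃ : 0 < m (ρ.im + v₂) * m (ρ.im + v₃) :=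
    mul_pos_of_continuousOn_of_ne_zero (by linarith) (continuousOn_Mfun_half_re x (by linarith))
      (fun u hu => hmne u (Or.inr ⟨hu.1, hu.2⟩))
  have hM₁ : Mfun x.ψ (ρ + beta1 c' D) = ((m (ρ.im + v₁) : ℝ) : ℂ) := by
    rw [hβ₁]; exact Mfun_half_eq_ofReal x (by linarith)
  have hM₂ : Mfun x.ψ (ρ + beta2 c' D) = ((m (ρ.im + v₂) : ℝ) : ℂ) := by
    rw [hβ₂]; exact Mfun_half_eq_ofReal x (by linarith)
  have hM₃ : Mfun x.ψ (ρ + beta3 c' D) = ((m (ρ.im + v₃) : ℝ) : ℂ) := by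
    rw [hβ₃]; exact Mfun_half_eq_ofReal x (by linarith)
  have hq : Mfun x.ψ (ρ + beta1 c' D) / (I * deriv (Mfun x.ψ) ρ)
      = ((m (ρ.im + v₁) / r : ℝ) : ℂ) := by
    rw [hM₁, ← hd_def, hId]; push_cast; ring
  have hw : Mfun x.ψ (ρ + beta2 c' D) * Mfun x.ψ (ρ + beta3 c' D)
      = ((m (ρ.im + v₂) * m (ρ.im + v₃) : ℝ) : ℂ) := by
    rw [hM₂, hM₃]; push_cast; ring
  have hqpos : 0 < m (ρ.im + v₁) / r := by
    have : m (ρ.im + v₁) / r = r * m (ρ.im + v₁) / (r * r) := by field_simp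
    rw [this]
    exact div_pos hsign₁ (mul_self_pos.mpr hr0)
  rw [hq, hw, Complex.ofReal_im, Complex.ofReal_re, Complex.ofReal_im, Complex.ofReal_re]
  exact ⟨⟨rfl, hqpos⟩, rfl, hsign₂₃⟩

/-- **Lemma 2.3 at one zero, from the windowed Proposition 2.2 at one character** (pp. 11–12):
`𝔠*(ρ,ψ)` is real and `≥ 0` for every `ρ ∈ 𝔷(ψ)`.
[cite: Zhang2022LandauSiegel, §2 proof of Lemma 2.3 pp. 11–12] -/
theorem cstar_nonneg_of_prop22W_at (hD : 3 ≤ D) (hχ : χ.IsPrimitive) {c' : ℝ} (hc' : 0 ≤ c')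
    (hsmall : 5 * c' * alpha D * ell D < 1) (hαhalf : alpha D ≤ 1 / 2) (x : Chr D)
    (h_i : ∀ s ∈ prodZeroSetOmega χ x, s.re = 1 / 2)
    (h_ii : ∀ s ∈ prodZeroSetOmega χ x,
      deriv (fun w => x.ψ.LFunction w * (psiChi χ x).LFunction w) s ≠ 0)
    (h_iii : ∀ s ∈ prodZeroSetOmega χ x, ∀ s' ∈ prodZeroSetOmega χ x,
      |s.im - 2 * π * t0 D| < ell1 D + 3 / 2 → s.im < s'.im →
        (∀ s'' ∈ prodZeroSetOmega χ x, ¬ (s.im < s''.im ∧ s''.im < s'.im)) →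
          |s'.im - s.im - alpha D| < c' * alpha D ^ 2 * ell D)
    {ρ : ℂ} (hρ : ρ ∈ zeroSet D x) :
    (cstar c' D x ρ).im = 0 ∧ 0 ≤ (cstar c' D x ρ).re := by
  have hρS : ρ ∈ prodZeroSetOmega χ x := mem_prodZeroSetOmega_of_mem_zeroSet χ hρ
  have hL1 : deriv x.ψ.LFunction ρ ≠ 0 :=
    deriv_LFunction_ne_zero_of_deriv_LL_ne_zero χ hD hχ x hρ.2.2 (h_ii ρ hρS)
  obtain ⟨⟨hqi, hqr⟩, hwi, hwr⟩ := M_signs_of_zeroFree_at hD hc' hsmall x hρ (h_i ρ hρS) hL1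
    (fun u hu => Mfun_half_ne_zero_of_prop22W_at χ hD hχ hc' hsmall hαhalf x h_iii hρ hu)
  rw [cstar_eq_mul]
  generalize Mfun x.ψ (ρ + beta1 c' D) / (I * deriv (Mfun x.ψ) ρ) = q at hqi hqr ⊢
  generalize Mfun x.ψ (ρ + beta2 c' D) * Mfun x.ψ (ρ + beta3 c' D) = w at hwi hwr ⊢
  rw [Complex.mul_im, Complex.mul_re, hqi, hwi, mul_zero, zero_mul, add_zero, mul_zero, sub_zero]
  exact ⟨rfl, (mul_pos hqr hwr).le⟩

end Setting

/-! ## The windowed leaf `Ded23W` discharged -/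

/-- **"`D` sufficiently large" from the windowed Proposition 2.2**: every statement that follows,
for `D ≥ 3`, `χ` primitive, `5c′α𝓛 < 1`, `α ≤ 1/2`, from (i), (ii) and the windowed (iii) at each
`ψ ∈ Ψ₁` holds for all large `D`. [cite: Zhang2022LandauSiegel, §2 p. 4] -/
theorem forAllLarge_of_prop22W {c' : ℝ} (h22 : Prop22W c')
    {S : (D : ℕ) → [NeZero D] → DirichletCharacter ℂ D → Prop}
    (hS : ∀ (D : ℕ) [NeZero D] (χ : DirichletCharacter ℂ D), 3 ≤ D → χ.IsPrimitive →
      5 * c' * alpha D * ell D < 1 → alpha D ≤ 1 / 2 →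
      (∀ x ∈ PsiOne χ,
        (∀ s ∈ prodZeroSetOmega χ x, s.re = 1 / 2) ∧
        (∀ s ∈ prodZeroSetOmega χ x,
          deriv (fun w => x.ψ.LFunction w * (psiChi χ x).LFunction w) s ≠ 0) ∧
        (∀ s ∈ prodZeroSetOmega χ x, ∀ s' ∈ prodZeroSetOmega χ x,
          |s.im - 2 * π * t0 D| < ell1 D + 3 / 2 → s.im < s'.im →
            (∀ s'' ∈ prodZeroSetOmega χ x, ¬ (s.im < s''.im ∧ s''.im < s'.im)) →
              |s'.im - s.im - alpha D| < c' * alpha D ^ 2 * ell D)) →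
      S D χ) :
    ForAllLarge S := by
  obtain ⟨h_i, h_ii, h_iii⟩ := h22
  obtain ⟨D₁, h⟩ := (h_i.and h_ii).and h_iii
  refine ⟨max (max D₁ 3) ⌈Real.exp (max 2 (5 * π * c' + 1))⌉₊, fun D _ χ hD hq hp => ?_⟩
  have hD₁ : D₁ ≤ D := le_trans (le_trans (le_max_left _ _) (le_max_left _ _)) hD
  have hD3 : 3 ≤ D := le_trans (le_trans (le_max_right _ _) (le_max_left _ _)) hD
  obtain ⟨hsmall, hαhalf⟩ := alpha_small_of_le (le_trans (le_max_right _ _) hD)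
  obtain ⟨⟨h1, h2⟩, h3⟩ := h D χ hD₁ hq hp
  exact hS D χ hD3 hp hsmall hαhalf fun x hx => ⟨h1 x hx, h2 x hx, h3 x hx⟩

/-- **The windowed leaf `Ded23W` HOLDS: Proposition 2.2 (with (iii) on the inner window
`|γ − 2πt₀| < 𝓛₁ + 3/2`) ⇒ Lemma 2.3**, for every `c′ ≥ 0` — the manuscript's proof of Lemma 2.3
(§2 pp. 11–12) only invokes the gap assertion at a zero of `𝔷(ψ)` and its two upper neighbours.
This discharges the hypothesis `hD23` of `Skeleton.theorem1_of_leaves_v7`.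
[cite: Zhang2022LandauSiegel, §2 Lemma 2.3 (proof) pp. 11–12] -/
theorem ded23W_holds {c' : ℝ} (hc' : 0 ≤ c') : Ded23W c' := fun h22 =>
  forAllLarge_of_prop22W h22 fun _ _ χ hD hp hsmall hαhalf h x hx _ hρ =>
    cstar_nonneg_of_prop22W_at χ hD hp hc' hsmall hαhalf x (h x hx).1 (h x hx).2.1 (h x hx).2.2 hρ

end Literature.NumberTheory.LFunctions.Zhang2022.Skeleton
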